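import Summits.HodgeConjecture.CorCM.DecicWeil23PairTwoTransitiveHodgeOfMarkman
import Summits.HodgeConjecture.CorCM.DecicWeil23PairFamilyHodgeOfMarkman
import Summits.HodgeConjecture.CorCM.DecicWeil23PairSingleTypeHodgeOfMarkman
import HarnessLib

/-!
# COR-CM — products of `(2,3)`-fivefolds over one DECIC CM field with `2`-TRANSITIVE quintic part: the FAMILY forms (two types,
# any realisations) and the ONE-TYPE form `E^a × B^n`, GIVEN ONLY Markman's hyperbolic-sixfold theorem

Cell `pub-hodgecm2` (COR-CM), seat b30 gen 23 (2026-08-22); count-neutral own lane DECIC-2T.  Theorems only; no definition, no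
named fact, no `sorry`.  HONEST FRAMING: CONDITIONAL on the single displayed named fact
`HodgeTheory.Markman2025_weilClasses_algebraic_hyperbolicSixfold` (arXiv:2502.03415 Thm 1.5.1, unrefereed); `HC_CM` is not
asserted and no case of the Hodge conjecture is claimed unconditionally.

The `2`-TRANSITIVE twins of gen 22's `CorCM/DecicWeil23PairFamilyHodgeOfMarkman` and `…SingleTypeHodgeOfMarkman`: the hypothesis
«`Aut(ℂ)` is `3`-transitive on the five embeddings of `K` over `τ`» (quintic part `A₅`/`S₅`) is replaced by `2`-TRANSITIVITY
(`h2T`; quintic part `S₅`, `A₅` or the Frobenius group `F₂₀`), through `hodgeConjectureFor_biproduct_comp_vec_of_markmanD_h2T`.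
* §1 **`hodgeConjectureFor_of_avDominatedBy_family_of_markmanD_h2T`** — any finite family `A_j ⊨ (K; Φ_j)` of CM fivefolds whose
  types take at most TWO values of `k`-signature `(2,3)`, `× E^a`, everything dominated; `…biproduct_family…` (no curve factor).
* §2 **`hodgeConjectureFor_biproduct_comp_vec₂_of_markmanD_h2T`** — ONE `(2,3)`-type: the Hodge conjecture for every
  `E^a × B^n`, `B ⊨ (K; Φ)` ANY CM abelian fivefold of `k`-signature `(2,3)` over a decic `K ⊇ i(k)` with `2`-transitive quintic
  part (a second type is realised by Shimura's existence theorem); `AVDominatedBy` and family forms.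
[cite: Markman2025SecantWeil, Thm 1.5.1] [cite: Shimura1998, §6.1 Thm. 2 Cor. and §6.2 Thm. 3] [cite: Pohlmann1968, Thm 1]
[cite: MumfordAV1970, §19] [cite: DixonMortimer1996, §2.1]

## References
* [Markman2025SecantWeil] E. Markman, arXiv:2502.03415 (unrefereed), Thm 1.5.1.  [Shimura1998] G. Shimura, *Abelian varieties
  with CM and modular functions*, §6.1 Thm. 2 Cor., §6.2 Thm. 3.  [Pohlmann1968] H. Pohlmann, Ann. of Math. 88 (1968), Thm 1.
  [MumfordAV1970] D. Mumford, *Abelian Varieties*, §19.  [DixonMortimer1996] J. D. Dixon, B. Mortimer, GTM 163 (1996), §2.1.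
-/

noncomputable section

open CategoryTheory CategoryTheory.Limits NumberField

namespace Summit.HodgeConjecture.CorCM.DecicWeil23Pair

open Literature.AlgebraicGeometry Literature.AlgebraicGeometry.Motives Literature.AlgebraicGeometry.HodgeTheory
open Literature.AlgebraicGeometry.ComplexMultiplication (IsCMTypeRealisation exists_isCMTypeRealisation)
open Literature.AlgebraicTopology.SingularHomology
open Summit.HodgeConjecture.CorCM.Domination (AVDominatedBy)
open Summit.HodgeConjecture.CorCM.AndreRiemann (sumFam avDominatedBy_prod_of_biproduct avDominatedBy_biproduct_reindex)

open scoped Classical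

/-! ## §1 Two types: the family form -/

section Family

variable {K : Type} [Field K] [NumberField K] [IsCMField K] {k : Type} [Field k] [NumberField k] [IsCMField k]
  {n : ℕ} {Φ : Fin n → CMType K} {A : Fin n → AbelianVariety ℂ} {ι : ∀ j, 𝓞 K →+* End (A j)}
  {θ : ∀ j, K →+* Module.End ℂ (complexBetti (A j).X 1)}
  {Ψ : CMType k} {E : AbelianVariety ℂ} {ιE : 𝓞 k →+* End E} {θE : k →+* Module.End ℂ (complexBetti E.X 1)}

/-- **THE FAMILY FORM (`2`-transitive).**  `K ⊇ i(k)` ANY CM field of degree `10` over the imaginary quadratic `k`, `τ : k → ℂ`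
with `Aut(ℂ)` `2`-TRANSITIVE on the five embeddings of `K` over `τ` (`h2T`); `A_j ⊨ (K; Φ_j)` (`j < n`) CM abelian fivefolds,
each `Φ_j` equal to `Φ_{j₁}` or to `Φ_{j₂}` (`hpos`), where `Φ_{j₁} ≠ Φ_{j₂}` have two members over `τ` each; `E ⊨ (k; Ψ ∋ τ)`.
Then every `C` dominated by `E^a × ⨁_j A_j` satisfies the Hodge conjecture, GIVEN ONLY Markman's hyperbolic-sixfold theorem.
[cite: Markman2025SecantWeil, Thm 1.5.1] [cite: Shimura1998, §6.1 Thm. 2 Cor.] [cite: MumfordAV1970, §19] -/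
theorem hodgeConjectureFor_of_avDominatedBy_family_of_markmanD_h2T
    (hM6 : Markman2025_weilClasses_algebraic_hyperbolicSixfold)
    (h10 : Module.finrank ℚ K = 10) (h2 : Module.finrank ℚ k = 2) (i : k →+* K)
    (hA : ∀ j, IsCMTypeRealisation (Φ j) (A j) (ι j) (θ j)) {τ : k →+* ℂ} (j₁ j₂ : Fin n)
    (h23₁ : (Finset.univ.filter fun s : K →+* ℂ => s.comp i = τ ∧ s ∈ (Φ j₁).1).card = 2)
    (h23₂ : (Finset.univ.filter fun s : K →+* ℂ => s.comp i = τ ∧ s ∈ (Φ j₂).1).card = 2) (hne : Φ j₁ ≠ Φ j₂)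
    (hpos : ∀ j, Φ j = Φ j₁ ∨ Φ j = Φ j₂)
    (h2T : ∀ x y : Fin 2 ↪ {s : K →+* ℂ // s.comp i = τ}, ∃ ρ : ℂ ≃+* ℂ, ∀ l : Fin 2, (ρ : ℂ →+* ℂ).comp (x l).1 = (y l).1)
    (hE : IsCMTypeRealisation Ψ E ιE θE) (hτΨ : τ ∈ Ψ.1) (a : ℕ)
    {C : AbelianVariety ℂ} (hC : AVDominatedBy C ((⨁ fun _ : Fin a => E).prod (⨁ A))) :
    HodgeConjectureFor C.dim C.X := by
  -- each `A_j` is dominated by `A_{j₁}` or `A_{j₂}`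
  let Bv : Fin 2 → AbelianVariety ℂ := ![A j₁, A j₂]
  have hdomB : ∀ j, ∃ m : Fin 2, AVDominatedBy (A j) (Bv m) := by
    intro j
    rcases hpos j with h | h
    · exact ⟨0, avDominatedBy_of_cmType_eq h (hA j) (hA j₁)⟩
    · exact ⟨1, avDominatedBy_of_cmType_eq h (hA j) (hA j₂)⟩
  choose m hm using hdomB
  -- domination of `E^a × ⨁ A` by a product of copies of `E, A j₁, A j₂`
  let Y : Fin 3 → AbelianVariety ℂ := ![E, A j₁, A j₂]
  have hYsucc : ∀ m : Fin 2, Y m.succ = Bv m := fun m => rfl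
  have h₁ : AVDominatedBy (⨁ fun _ : Fin a => E) (⨁ fun _ : Fin a => Y 0) :=
    AVDominatedBy.biproduct_map fun _ => AVDominatedBy.refl E
  have h₂ : AVDominatedBy (⨁ A) (⨁ fun j => Y (m j).succ) :=
    AVDominatedBy.biproduct_map fun j => by rw [hYsucc]; exact hm j
  have h₁₂' := avDominatedBy_prod_of_biproduct h₁ h₂
  let κ' : Fin a ⊕ Fin n → Fin 3 := Sum.elim (fun _ => 0) fun j => (m j).succ
  have hfam : sumFam (fun _ : Fin a => Y 0) (fun j => Y (m j).succ) = Y ∘ κ' := funext fun x => by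
    cases x <;> rfl
  rw [hfam] at h₁₂'
  have hdom := avDominatedBy_biproduct_reindex finSumFinEquiv.symm h₁₂'
  exact Domination.hodgeConjectureFor_of_avDominatedBy
    (hodgeConjectureFor_biproduct_comp_vec_of_markmanD_h2T hM6 h10 h2 i (hA j₁) (hA j₂) hE hτΨ h23₁ h23₂ hne h2T
      (κ' ∘ finSumFinEquiv.symm)) (hC.trans hdom)

/-- **In particular: the Hodge conjecture for `∏_j A_j` itself** (no curve factor; e.g. `B₁ × B₂`, the carrier of the TENFOLD Weil
classes of `B₁ × B̄₂`), `2`-transitive form, GIVEN ONLY Markman's sixfold theorem. [cite: Markman2025SecantWeil, Thm 1.5.1]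
[cite: MumfordAV1970, §19] -/
theorem hodgeConjectureFor_biproduct_family_of_markmanD_h2T
    (hM6 : Markman2025_weilClasses_algebraic_hyperbolicSixfold)
    (h10 : Module.finrank ℚ K = 10) (h2 : Module.finrank ℚ k = 2) (i : k →+* K)
    (hA : ∀ j, IsCMTypeRealisation (Φ j) (A j) (ι j) (θ j)) {τ : k →+* ℂ} (j₁ j₂ : Fin n)
    (h23₁ : (Finset.univ.filter fun s : K →+* ℂ => s.comp i = τ ∧ s ∈ (Φ j₁).1).card = 2)
    (h23₂ : (Finset.univ.filter fun s : K →+* ℂ => s.comp i = τ ∧ s ∈ (Φ j₂).1).card = 2) (hne : Φ j₁ ≠ Φ j₂)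
    (hpos : ∀ j, Φ j = Φ j₁ ∨ Φ j = Φ j₂)
    (h2T : ∀ x y : Fin 2 ↪ {s : K →+* ℂ // s.comp i = τ}, ∃ ρ : ℂ ≃+* ℂ, ∀ l : Fin 2, (ρ : ℂ →+* ℂ).comp (x l).1 = (y l).1)
    (hE : IsCMTypeRealisation Ψ E ιE θE) (hτΨ : τ ∈ Ψ.1) :
    HodgeConjectureFor (⨁ A).dim (⨁ A).X :=
  hodgeConjectureFor_of_avDominatedBy_family_of_markmanD_h2T hM6 h10 h2 i hA j₁ j₂ h23₁ h23₂ hne hpos h2T hE hτΨ 0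
    (C := ⨁ A) ⟨AbelianVariety.prodLift 0 (𝟙 _), AbelianVariety.snd _ _, 1, one_ne_zero, by
      rw [AbelianVariety.prodLift_snd, one_smul]⟩

end Family

/-! ## §2 One `(2,3)`-type: `E^a × B^n` -/

section Single

variable {K : Type} [Field K] [NumberField K] [IsCMField K] {k : Type} [Field k] [NumberField k] [IsCMField k] {N : ℕ}
  {Φ : CMType K} {B : AbelianVariety ℂ} {ι : 𝓞 K →+* End B} {θ : K →+* Module.End ℂ (complexBetti B.X 1)}
  {Ψ : CMType k} {E : AbelianVariety ℂ} {ιE : 𝓞 k →+* End E} {θE : k →+* Module.End ℂ (complexBetti E.X 1)}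

/-- **THE HODGE CONJECTURE FOR EVERY PRODUCT OF COPIES `E^a × B^n` OF ONE CM FIVEFOLD OF `k`-SIGNATURE `(2,3)` AND THE CM CURVE
OF `k`, GIVEN ONLY Markman's hyperbolic-sixfold theorem — `2`-TRANSITIVE form.**  `K ⊇ i(k)` ANY CM field of degree `10` over the
imaginary quadratic `k` such that `Aut(ℂ)` permutes the five embeddings of `K` over `τ` `2`-TRANSITIVELY (`h2T`; `K = K⁺k` with
`Gal((K⁺)ᶜ/ℚ) = S₅`, `A₅` or `F₂₀`), `B ⊨ (K; Φ)` a CM abelian fivefold with exactly two members of `Φ` over `τ`, `E ⊨ (k; Ψ ∋ τ)`: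
for every `κ : Fin N → Fin 2`, every rational `(q,q)`-class on `⨁_j ![E, B] (κ j)` is algebraic (a second `(2,3)`-type
`Φ' ≠ Φ` — `exists_cmType_ne₂₃` — is realised by some `B'` by Shimura's existence theorem, and the two-type theorem applies to
`(E, B, B')`). [cite: Markman2025SecantWeil, Thm 1.5.1] [cite: Shimura1998, §6.2 Thm. 3] [cite: Pohlmann1968, Thm 1]
[cite: MumfordAV1970, §19] -/
theorem hodgeConjectureFor_biproduct_comp_vec₂_of_markmanD_h2T
    (hM6 : Markman2025_weilClasses_algebraic_hyperbolicSixfold)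
    (h10 : Module.finrank ℚ K = 10) (h2 : Module.finrank ℚ k = 2) (i : k →+* K)
    (hB : IsCMTypeRealisation Φ B ι θ) (hE : IsCMTypeRealisation Ψ E ιE θE) {τ : k →+* ℂ} (hτΨ : τ ∈ Ψ.1)
    (h23 : (Finset.univ.filter fun s : K →+* ℂ => s.comp i = τ ∧ s ∈ Φ.1).card = 2)
    (h2T : ∀ x y : Fin 2 ↪ {s : K →+* ℂ // s.comp i = τ}, ∃ ρ : ℂ ≃+* ℂ, ∀ j : Fin 2, (ρ : ℂ →+* ℂ).comp (x j).1 = (y j).1)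
    (κ : Fin N → Fin 2) :
    HodgeConjectureFor (⨁ fun j => (![E, B] : Fin 2 → AbelianVariety ℂ) (κ j)).dim
      (⨁ fun j => (![E, B] : Fin 2 → AbelianVariety ℂ) (κ j)).X := by
  have hττ : ComplexEmbedding.conjugate τ ≠ τ := QuarticCM.conjugate_ne τ
  have hk : ∀ σ : k →+* ℂ, σ = τ ∨ σ = ComplexEmbedding.conjugate τ := fun σ =>
    QuarticCM.eq_or_eq_conjugate_of_quadratic h2 τ σ
  obtain ⟨Φ', h23', hne⟩ := exists_cmType_ne₂₃ h10 h2 i hττ hk Φ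
  obtain ⟨B', ι', θ', hB'⟩ := exists_isCMTypeRealisation Φ'
  -- slots `0, 1` of `(E, B, B')` are `(E, B)`
  have hslot : ∀ x : Fin 2, (![E, B, B'] : Fin 3 → AbelianVariety ℂ) (Fin.castSucc x) =
      (![E, B] : Fin 2 → AbelianVariety ℂ) x := by
    intro x
    fin_cases x <;> rfl
  have hdom : AVDominatedBy (⨁ fun j => (![E, B] : Fin 2 → AbelianVariety ℂ) (κ j))
      (⨁ fun j => (![E, B, B'] : Fin 3 → AbelianVariety ℂ) ((Fin.castSucc ∘ κ) j)) :=
    AVDominatedBy.biproduct_map fun j => by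
      rw [Function.comp_apply, hslot]
      exact AVDominatedBy.refl _
  exact hodgeConjectureFor_of_avDominatedBy_comp_vec_of_markmanD_h2T hM6 h10 h2 i hB hB' hE hτΨ h23 h23' hne h2T
    (Fin.castSucc ∘ κ) hdom

/-- **Everything dominated by a product of copies of `E, B`** (abelian subvarieties, quotients, isogenous varieties) satisfies the
Hodge conjecture, `2`-transitive form, GIVEN ONLY Markman's sixfold theorem. [cite: Markman2025SecantWeil, Thm 1.5.1]
[cite: MumfordAV1970, §19] -/
theorem hodgeConjectureFor_of_avDominatedBy_comp_vec₂_of_markmanD_h2T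
    (hM6 : Markman2025_weilClasses_algebraic_hyperbolicSixfold)
    (h10 : Module.finrank ℚ K = 10) (h2 : Module.finrank ℚ k = 2) (i : k →+* K)
    (hB : IsCMTypeRealisation Φ B ι θ) (hE : IsCMTypeRealisation Ψ E ιE θE) {τ : k →+* ℂ} (hτΨ : τ ∈ Ψ.1)
    (h23 : (Finset.univ.filter fun s : K →+* ℂ => s.comp i = τ ∧ s ∈ Φ.1).card = 2)
    (h2T : ∀ x y : Fin 2 ↪ {s : K →+* ℂ // s.comp i = τ}, ∃ ρ : ℂ ≃+* ℂ, ∀ j : Fin 2, (ρ : ℂ →+* ℂ).comp (x j).1 = (y j).1)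
    (κ : Fin N → Fin 2) {C : AbelianVariety ℂ}
    (hC : AVDominatedBy C (⨁ fun j => (![E, B] : Fin 2 → AbelianVariety ℂ) (κ j))) :
    HodgeConjectureFor C.dim C.X :=
  Domination.hodgeConjectureFor_of_avDominatedBy
    (hodgeConjectureFor_biproduct_comp_vec₂_of_markmanD_h2T hM6 h10 h2 i hB hE hτΨ h23 h2T κ) hC

end Single

/-! ## §3 The family form for ONE type -/

section Family₁

variable {K : Type} [Field K] [NumberField K] [IsCMField K] {k : Type} [Field k] [NumberField k] [IsCMField k]
  {n : ℕ} {Φ : Fin n → CMType K} {A : Fin n → AbelianVariety ℂ} {ι : ∀ j, 𝓞 K →+* End (A j)}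
  {θ : ∀ j, K →+* Module.End ℂ (complexBetti (A j).X 1)}
  {Ψ : CMType k} {E : AbelianVariety ℂ} {ιE : 𝓞 k →+* End E} {θE : k →+* Module.End ℂ (complexBetti E.X 1)}

/-- **THE FAMILY FORM, ONE TYPE (`2`-transitive).**  `A_j ⊨ (K; Φ_j)` (`j < n`) CM abelian fivefolds all of the SAME type
`Φ_j = Φ_{j₁}` of `k`-signature `(2,3)` (e.g. the Galois conjugates of one CM fivefold sharing its type, any CM structures),
`K ⊇ i(k)` decic with `Aut(ℂ)` `2`-transitive over `τ`, `E ⊨ (k; Ψ ∋ τ)`: every `C` dominated by `E^a × ⨁_j A_j` satisfies the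
Hodge conjecture, GIVEN ONLY Markman's sixfold theorem. [cite: Markman2025SecantWeil, Thm 1.5.1] [cite: Shimura1998, §6.1 Thm. 2 Cor.]
[cite: MumfordAV1970, §19] -/
theorem hodgeConjectureFor_of_avDominatedBy_family₁_of_markmanD_h2T
    (hM6 : Markman2025_weilClasses_algebraic_hyperbolicSixfold)
    (h10 : Module.finrank ℚ K = 10) (h2 : Module.finrank ℚ k = 2) (i : k →+* K)
    (hA : ∀ j, IsCMTypeRealisation (Φ j) (A j) (ι j) (θ j)) {τ : k →+* ℂ} (j₁ : Fin n)
    (h23 : (Finset.univ.filter fun s : K →+* ℂ => s.comp i = τ ∧ s ∈ (Φ j₁).1).card = 2) (hpos : ∀ j, Φ j = Φ j₁)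
    (h2T : ∀ x y : Fin 2 ↪ {s : K →+* ℂ // s.comp i = τ}, ∃ ρ : ℂ ≃+* ℂ, ∀ l : Fin 2, (ρ : ℂ →+* ℂ).comp (x l).1 = (y l).1)
    (hE : IsCMTypeRealisation Ψ E ιE θE) (hτΨ : τ ∈ Ψ.1) (a : ℕ)
    {C : AbelianVariety ℂ} (hC : AVDominatedBy C ((⨁ fun _ : Fin a => E).prod (⨁ A))) :
    HodgeConjectureFor C.dim C.X := by
  have hdomB : ∀ j, AVDominatedBy (A j) (A j₁) := fun j => avDominatedBy_of_cmType_eq (hpos j) (hA j) (hA j₁)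
  let Y : Fin 2 → AbelianVariety ℂ := ![E, A j₁]
  have h₁ : AVDominatedBy (⨁ fun _ : Fin a => E) (⨁ fun _ : Fin a => Y 0) :=
    AVDominatedBy.biproduct_map fun _ => AVDominatedBy.refl E
  have h₂ : AVDominatedBy (⨁ A) (⨁ fun _ : Fin n => Y 1) :=
    AVDominatedBy.biproduct_map fun j => hdomB j
  have h₁₂' := avDominatedBy_prod_of_biproduct h₁ h₂
  let κ' : Fin a ⊕ Fin n → Fin 2 := Sum.elim (fun _ => 0) fun _ => 1
  have hfam : sumFam (fun _ : Fin a => Y 0) (fun _ : Fin n => Y 1) = Y ∘ κ' := funext fun x => by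
    cases x <;> rfl
  rw [hfam] at h₁₂'
  have hdom := avDominatedBy_biproduct_reindex finSumFinEquiv.symm h₁₂'
  exact Domination.hodgeConjectureFor_of_avDominatedBy
    (hodgeConjectureFor_biproduct_comp_vec₂_of_markmanD_h2T hM6 h10 h2 i (hA j₁) hE hτΨ h23 h2T (κ' ∘ finSumFinEquiv.symm))
    (hC.trans hdom)

/-- **In particular: the Hodge conjecture for `∏_j A_j` itself** — every product of members of ONE `(2,3)`-isogeny class over a
decic CM field with `2`-transitive quintic part (e.g. `B^n`), GIVEN ONLY Markman's sixfold theorem.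
[cite: Markman2025SecantWeil, Thm 1.5.1] [cite: MumfordAV1970, §19] -/
theorem hodgeConjectureFor_biproduct_family₁_of_markmanD_h2T
    (hM6 : Markman2025_weilClasses_algebraic_hyperbolicSixfold)
    (h10 : Module.finrank ℚ K = 10) (h2 : Module.finrank ℚ k = 2) (i : k →+* K)
    (hA : ∀ j, IsCMTypeRealisation (Φ j) (A j) (ι j) (θ j)) {τ : k →+* ℂ} (j₁ : Fin n)
    (h23 : (Finset.univ.filter fun s : K →+* ℂ => s.comp i = τ ∧ s ∈ (Φ j₁).1).card = 2) (hpos : ∀ j, Φ j = Φ j₁)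
    (h2T : ∀ x y : Fin 2 ↪ {s : K →+* ℂ // s.comp i = τ}, ∃ ρ : ℂ ≃+* ℂ, ∀ l : Fin 2, (ρ : ℂ →+* ℂ).comp (x l).1 = (y l).1)
    (hE : IsCMTypeRealisation Ψ E ιE θE) (hτΨ : τ ∈ Ψ.1) :
    HodgeConjectureFor (⨁ A).dim (⨁ A).X :=
  hodgeConjectureFor_of_avDominatedBy_family₁_of_markmanD_h2T hM6 h10 h2 i hA j₁ h23 hpos h2T hE hτΨ 0
    (C := ⨁ A) ⟨AbelianVariety.prodLift 0 (𝟙 _), AbelianVariety.snd _ _, 1, one_ne_zero, by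
      rw [AbelianVariety.prodLift_snd, one_smul]⟩

end Family₁

end Summit.HodgeConjecture.CorCM.DecicWeil23Pair

end
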